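import Summits.ResolutionOfSingularities.ResolutionOfSingularities.Theorems.PlanarGhostDescentStatesB
import HarnessLib

/-!
# PlanarGhostDescent — decomp-res node «GhostDescent» (lens-5 g27, critic row 183 CLEARED DECIDED +1 · MAP 0), tree
file 3/3 of the node

Content VERBATIM from the decomp-res lens-5 g27 node `HOME/decomp-res-lens-5/g27/PlanarGhostDescent.lean` (pin
53b88513); imports the landed tree only, carries nothing;
HOME = run/shared/lean/pub/decomp-res; critic row 183 CLEARED DECIDED +1 · MAP 0; landing orders INBOX :923/:931 —
provenance, critic text and the lens header in full in the first file of the node,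
`PlanarGhostDescentStates`.  Namespace `…Theorems.GhostDescent`; `--supports stmt-ResolutionOfSingularities-31770`.

## This file

§2 WALK LEVEL — the order window along a forced walk (from `W.isolated`), the DESCENT of the wall layer `0` (the
ℕ-valued `smz`, halving at repeats), the KILL `layer_zero_not_monomialLed`; §3 THE CLASSES — THE PLANAR SIDE OF
31770 IS EMPTY: **`noMonomialLedPlanarJointTailsDeep_holds : CoefficientCut.NoMonomialLedPlanarJointTailsDeep`** (=
the Theses aside `MaxContactCut.CFNoMonomialLedPlanarJointTailsDeep`, item 28121, BY DEFINITION — closed PROVED by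
the 3-line `Theorems/MaxContactCutPlanarClosed.lean`), `noPlanarJointTailsDeep_holds`,
`noHighPlanarJointTailsDeep_holds`, the five section-class theorems incl. (T-2′)
`noLowLiveTerminalSectionPlanarTailsDeep_holds` and (T-1′) `noLowEmptyIsolatedSectionTailsDeep_holds`; THE NODE
EQUATION **`defectWalksDeep_iff_skew : DefectWalksDeep ↔ NoSkewJointTailsDeep`** (`defectWalksDeep_iff_skewLeaves`);
`closes (hR)` (continued `…B` where the cap cuts).

[WRITER NOTE (decomp-res writer g11): file split only (tree files ≤ 400 lines); `noncomputable section`, namespace,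
sections, section variables, the `open` lines and every
declaration exactly as in the lens; no instance, no notation, no include/omit added.; DEDUP (gate p811967
`dedup.landed`): the lens's re-proofs `skew_of_defectWalksDeep` (≡ the landed
`CoefficientCut.skew_of_defectWalksDeep`, `Theorems/MaxContactCutCoefficientCut.lean`) and
`noLowEmptyIsolatedSectionTailsDeep_holds` (≡ the landed `CurveTrap.noLowEmptyIsolatedSectionTailsDeep_holds`,
`Theorems/PlanarCurveTrap2.lean`, decomp-res node «CurveTrap») are DELETED here — cite those declarations]

(Sources: Hauser2010Kangaroo §F; HauserPerlega2019; HauserPerlega2024; Moh1987; CossartPiltant2008;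
CossartJannsenSaito2020 Ch. 6.)
-/

noncomputable section

open MvPolynomial Finset
open Literature.AlgebraicGeometry.Resolution
open Literature.AlgebraicGeometry.Resolution.Hauser2010
open Literature.AlgebraicGeometry.Resolution.PointBlowup
open Literature.AlgebraicGeometry.Resolution.WeightedBlowup
open Summit.ResolutionOfSingularities.ResolutionOfSingularities.Theses
open Summit.ResolutionOfSingularities.ResolutionOfSingularities.Theorems.TightDefectClasses
open Summit.ResolutionOfSingularities.ResolutionOfSingularities.Theorems.TightDefectStrongWalks
open Summit.ResolutionOfSingularities.ResolutionOfSingularities.Theorems.ItineraryCutClasses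
open Summit.ResolutionOfSingularities.ResolutionOfSingularities.Theorems.ProximityCut
open Summit.ResolutionOfSingularities.ResolutionOfSingularities.Theorems.ExitLaw
open Summit.ResolutionOfSingularities.ResolutionOfSingularities.Theorems.PlanarCut
open Summit.ResolutionOfSingularities.ResolutionOfSingularities.Theorems.CoefficientCut

namespace Summit.ResolutionOfSingularities.ResolutionOfSingularities.Theorems.GhostDescent

section Walk

open Summit.ResolutionOfSingularities.ResolutionOfSingularities.Theorems.PlanarPort
variable {K : Type} [Field K] [DecidableEq K] {q : ℕ} {s₀ : State (Fin 3) K}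
variable {i j k : Fin 3} (hij : i ≠ j) (hjk : j ≠ k) (hik : i ≠ k)
include hij hjk hik

/-! ## §2 Walk level: the order window, the descent of the wall layer `0`, the kill -/

omit hij hjk hik in
/-- On an excess plateau (`ord F_t ≠ q`, so `ord F_t ≥ q + 1`) every monomial has degree `≥ q + 1`. [folklore] -/
theorem succ_le_degree_of_mem_support (hs : IsRoot q s₀) (W : ForcedWalk q s₀) {t : ℕ}
    (hex : ordZero (W.st t).F ≠ (q : ℕ∞)) {d : Fin 3 →₀ ℕ} (hd : d ∈ (W.st t).F.support) : q + 1 ≤ d.degree := by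
  obtain ⟨o, ho, hqo⟩ := walk_nat hs W t
  have hoq : o ≠ q := fun h => hex (by rw [ho, h])
  by_contra hlt
  push Not at hlt
  refine (MvPolynomial.mem_support_iff.mp hd) (coeff_eq_zero_of_degree_lt_ordZero ?_)
  rw [ho]
  exact_mod_cast (by omega : d.degree < o)

/-- … so the wall layer `0`, when non-empty, has least degree `n₀ > q`. [folklore] -/
theorem lt_loSum_zero (hs : IsRoot q s₀) (W : ForcedWalk q s₀) {t : ℕ} (hex : ordZero (W.st t).F ≠ (q : ℕ∞))
    (hne : (layer k 0 (W.st t).F).Nonempty) : q < loSum (layer k 0 (W.st t).F) i j := by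
  refine le_loSum hne fun d hd => ?_
  have hd' := mem_layer.mp hd
  have h1 := succ_le_degree_of_mem_support hs W hex (MvPolynomial.mem_support_iff.mpr hd'.1)
  have h3 := degree_three hij hjk hik d
  omega

/-- **THE ORDER WINDOW (PROVED, hypothesis-free): on a planar tail whose live wall layers `1 … q−1` are monomial-led,
a TRANSLATED move happens only while the wall layer `0` has least degree `n₀ < 2q`.**  Otherwise the new state is fat
off the translation letter (`fat_of_heavy_layer_zero`) and its top locus contains an axis (`not_isolatedTop_of_fat`),
against `W.isolated (t+1)`.  This is what guards the lowest row of the wall layer `0` from the cleaning. [new]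
[folklore] -/
theorem loSum_zero_lt_two_mul (hs : IsRoot q s₀) (W : ForcedWalk q s₀) {N : ℕ}
    (hP : ∀ t, N ≤ t → W.j t ≠ k ∧ W.b t k = 0)
    (hdead : ∀ t, N ≤ t → ∀ a, 1 ≤ a → a < q → sm (layer k a (W.st t).F) i j = 0)
    {t : ℕ} (ht : N ≤ t) (hbt : W.b t ≠ 0) : loSum (layer k 0 (W.st t).F) i j < 2 * q := by
  classical
  by_contra hge
  push Not at hge
  have hF : ∀ d ∈ (W.st t).F.support, q ≤ d.degree := fun d hd => le_degree_of_mem_support hs W t hd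
  have hF' : ∀ d ∈ (step q (W.j t) (W.b t) (W.st t)).F.support, q ≤ d.degree := by
    intro d hd
    rw [← st_succ_F] at hd
    exact le_degree_of_mem_support hs W (t + 1) hd
  have hiso := W.isolated (t + 1)
  rw [st_succ_F] at hiso
  have hheavy : ∀ d ∈ layer k 0 (W.st t).F, 2 * q ≤ d i + d j := fun d hd => le_trans hge (loSum_le hd i j)
  have hchart : W.j t = i ∨ W.j t = j := by
    rcases fin3_cases ⟨hij, hjk, hik⟩ (W.j t) with h | h | h
    · exact Or.inl h
    · exact Or.inr h
    · exact absurd h (hP t ht).1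
  rcases translated_letter hij hjk hik hbt (W.onExc t) (hP t ht).2 hchart with ⟨hl, hbi⟩ | ⟨hl, hbj⟩
  · rw [hl] at hF' hiso
    exact not_isolatedTop_of_fat q i _ (fat_of_heavy_layer_zero hij hjk hik q (W.b t)
      (by rw [← hl]; exact W.onExc t) (hP t ht).2 hbi (W.st t) hF hF' hheavy (hdead t ht)) hiso
  · rw [hl] at hF' hiso
    exact not_isolatedTop_of_fat q j _ (fat_of_heavy_layer_zero hij.symm hik hjk q (W.b t)
      (by rw [← hl]; exact W.onExc t) (hP t ht).2 hbj (W.st t) hF hF'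
      (fun d hd => by rw [add_comm]; exact hheavy d hd)
      (fun a ha1 haq => by rw [PlanarCut.sm_comm]; exact hdead t ht a ha1 haq)) hiso

/-- The STRICT MULTIPLICITY OF THE WALL LAYER `0` along the walk — the node's controlling quantity (the multiplicity at
the current point of the strict transform of the plane curve `{G = 0}`, `G` = wall layer `0` / its monomial content).
DEFINITION (support). -/
noncomputable def smz (W : ForcedWalk q s₀) (k i j : Fin 3) (t : ℕ) : ℕ :=
  sm (layer k 0 (W.st t).F) i j

/-- **MONOTONICITY along the tail (PROVED).** [new] [folklore] -/
theorem smz_succ_le (hs : IsRoot q s₀) (W : ForcedWalk q s₀) {N : ℕ}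
    (hP : ∀ t, N ≤ t → W.j t ≠ k ∧ W.b t k = 0) (hex : ∀ t, N ≤ t → ordZero (W.st t).F ≠ (q : ℕ∞))
    (h0 : ∀ t, N ≤ t → ∃ d ∈ (W.st t).F.support, d k = 0)
    (hdead : ∀ t, N ≤ t → ∀ a, 1 ≤ a → a < q → sm (layer k a (W.st t).F) i j = 0)
    {t : ℕ} (ht : N ≤ t) : smz W k i j (t + 1) ≤ smz W k i j t := by
  classical
  have hF : ∀ d ∈ (W.st t).F.support, q ≤ d.degree := fun d hd => le_degree_of_mem_support hs W t hd
  have hclean := walk_clean hs W t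
  have hne : (layer k 0 (W.st t).F).Nonempty := by
    obtain ⟨d, hd, hk⟩ := h0 t ht
    exact ⟨d, mem_layer.mpr ⟨MvPolynomial.mem_support_iff.mp hd, hk⟩⟩
  have hrange : W.b t ≠ 0 →
      q < loSum (layer k 0 (W.st t).F) i j ∧ loSum (layer k 0 (W.st t).F) i j < 2 * q := fun hbt =>
    ⟨lt_loSum_zero hij hjk hik hs W (hex t ht) hne, loSum_zero_lt_two_mul hij hjk hik hs W hP hdead ht hbt⟩
  unfold smz
  rw [st_succ_F]
  rcases fin3_cases ⟨hij, hjk, hik⟩ (W.j t) with h | h | h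
  · -- chart `u_i`: roles `(j, i, k)`
    rw [h, PlanarCut.sm_comm, PlanarCut.sm_comm (S := layer k 0 (W.st t).F)]
    refine sm_zero_step_le hij.symm hik hjk q (W.b t) (by rw [← h]; exact W.onExc t) (hP t ht).2 (W.st t) hF
      hclean fun hb => ?_
    rw [loSum_comm]
    exact hrange fun hb0 => hb (by rw [hb0]; rfl)
  · rw [h]
    exact sm_zero_step_le hij hjk hik q (W.b t) (by rw [← h]; exact W.onExc t) (hP t ht).2 (W.st t) hF hclean
      fun hb => hrange fun hb0 => hb (by rw [hb0]; rfl)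
  · exact absurd h (hP t ht).1

/-- `smz_mono`: the wall-layer-`0` strict multiplicity is non-increasing along the tail. [folklore] -/
theorem smz_mono (hs : IsRoot q s₀) (W : ForcedWalk q s₀) {N : ℕ}
    (hP : ∀ t, N ≤ t → W.j t ≠ k ∧ W.b t k = 0) (hex : ∀ t, N ≤ t → ordZero (W.st t).F ≠ (q : ℕ∞))
    (h0 : ∀ t, N ≤ t → ∃ d ∈ (W.st t).F.support, d k = 0)
    (hdead : ∀ t, N ≤ t → ∀ a, 1 ≤ a → a < q → sm (layer k a (W.st t).F) i j = 0)
    {t t' : ℕ} (ht : N ≤ t) (htt' : t ≤ t') : smz W k i j t' ≤ smz W k i j t := by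
  induction t', htt' using Nat.le_induction with
  | base => exact le_rfl
  | succ t' htt' ih => exact (smz_succ_le hij hjk hik hs W hP hex h0 hdead (by omega)).trans ih

/-- **DESCENT AT A PLANAR PROXIMITY REPEAT (PROVED):** `smz (t+2) + smz (t+1) ≤ smz t` when step `t+1` stays on the
newest divisor. [new] [folklore] -/
theorem smz_succ_succ_le (hs : IsRoot q s₀) (W : ForcedWalk q s₀) {N : ℕ}
    (hP : ∀ t, N ≤ t → W.j t ≠ k ∧ W.b t k = 0) (hex : ∀ t, N ≤ t → ordZero (W.st t).F ≠ (q : ℕ∞))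
    (h0 : ∀ t, N ≤ t → ∃ d ∈ (W.st t).F.support, d k = 0)
    (hdead : ∀ t, N ≤ t → ∀ a, 1 ≤ a → a < q → sm (layer k a (W.st t).F) i j = 0)
    {t : ℕ} (ht : N ≤ t) (hS : StaysOnNewest W t) :
    smz W k i j (t + 2) + smz W k i j (t + 1) ≤ smz W k i j t := by
  classical
  have hF : ∀ d ∈ (W.st t).F.support, q ≤ d.degree := fun d hd => le_degree_of_mem_support hs W t hd
  have hF' : ∀ d ∈ (step q (W.j t) (W.b t) (W.st t)).F.support, q ≤ d.degree := by
    intro d hd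
    rw [← st_succ_F] at hd
    exact le_degree_of_mem_support hs W (t + 1) hd
  have hclean := walk_clean hs W t
  have hclean' : deletePthPowers q (step q (W.j t) (W.b t) (W.st t)).F = (step q (W.j t) (W.b t) (W.st t)).F := by
    rw [← st_succ_F]
    exact walk_clean hs W (t + 1)
  have hne : (layer k 0 (W.st t).F).Nonempty := by
    obtain ⟨d, hd, hk⟩ := h0 t ht
    exact ⟨d, mem_layer.mpr ⟨MvPolynomial.mem_support_iff.mp hd, hk⟩⟩
  have hrange : W.b t ≠ 0 →
      q < loSum (layer k 0 (W.st t).F) i j ∧ loSum (layer k 0 (W.st t).F) i j < 2 * q := fun hbt =>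
    ⟨lt_loSum_zero hij hjk hik hs W (hex t ht) hne, loSum_zero_lt_two_mul hij hjk hik hs W hP hdead ht hbt⟩
  obtain ⟨hjk0, hbk0⟩ := hP t ht
  obtain ⟨hjk1, hbk1⟩ := hP (t + 1) (by omega)
  obtain ⟨hne1, hbS⟩ := hS
  have hb1 : W.b (t + 1) = 0 := by
    funext l
    rcases fin3_cases ⟨hne1, hjk0, hjk1⟩ l with rfl | rfl | rfl
    · exact W.onExc (t + 1)
    · exact hbS
    · exact hbk1
  have h2 : (W.st (t + 2)).F = (step q (W.j (t + 1)) 0 (step q (W.j t) (W.b t) (W.st t))).F := by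
    rw [← hb1, ← W.st_succ t, ← W.st_succ (t + 1)]
  unfold smz
  rw [h2, st_succ_F W t]
  rcases fin3_cases ⟨hij, hjk, hik⟩ (W.j t) with h | h | h
  · -- chart `u_i` then `u_j`: roles `(j, i, k)`
    have h1 : W.j (t + 1) = j := by
      rcases fin3_cases ⟨hij, hjk, hik⟩ (W.j (t + 1)) with h' | h' | h'
      · exact absurd (h'.trans h.symm) hne1
      · exact h'
      · exact absurd h' hjk1
    rw [h, h1, PlanarCut.sm_comm, PlanarCut.sm_comm (S := layer k 0 (step q i (W.b t) (W.st t)).F),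
      PlanarCut.sm_comm (S := layer k 0 (W.st t).F)]
    rw [h] at hF' hclean'
    refine sm_zero_step_step_le hij.symm hik hjk q (W.b t) (by rw [← h]; exact W.onExc t) hbk0 (W.st t) hF hF'
      hclean hclean' fun hb => ?_
    rw [loSum_comm]
    exact hrange fun hb0 => hb (by rw [hb0]; rfl)
  · have h1 : W.j (t + 1) = i := by
      rcases fin3_cases ⟨hij, hjk, hik⟩ (W.j (t + 1)) with h' | h' | h'
      · exact h'
      · exact absurd (h'.trans h.symm) hne1
      · exact absurd h' hjk1
    rw [h, h1]
    rw [h] at hF' hclean'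
    exact sm_zero_step_step_le hij hjk hik q (W.b t) (by rw [← h]; exact W.onExc t) hbk0 (W.st t) hF hF'
      hclean hclean' fun hb => hrange fun hb0 => hb (by rw [hb0]; rfl)
  · exact absurd h hjk0

/-- **THE WALL LAYER `0` BECOMES MONOMIAL-LED (PROVED):** infinitely many proximity repeats on the tail force
`smz T = 0` for some `T ≥ N` (each repeat at least halves it). [new] [folklore] -/
theorem exists_smz_eq_zero (hs : IsRoot q s₀) (W : ForcedWalk q s₀) {N : ℕ}
    (hP : ∀ t, N ≤ t → W.j t ≠ k ∧ W.b t k = 0) (hex : ∀ t, N ≤ t → ordZero (W.st t).F ≠ (q : ℕ∞))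
    (h0 : ∀ t, N ≤ t → ∃ d ∈ (W.st t).F.support, d k = 0)
    (hdead : ∀ t, N ≤ t → ∀ a, 1 ≤ a → a < q → sm (layer k a (W.st t).F) i j = 0)
    (hSio : ∀ M : ℕ, ∃ t, M ≤ t ∧ StaysOnNewest W t) :
    ∃ T, N ≤ T ∧ smz W k i j T = 0 := by
  suffices h : ∀ n t, N ≤ t → smz W k i j t ≤ n → ∃ T, N ≤ T ∧ smz W k i j T = 0 from h _ N le_rfl le_rfl
  intro n
  induction n using Nat.strong_induction_on with
  | _ n ih =>
    intro t ht hle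
    rcases Nat.eq_zero_or_pos (smz W k i j t) with hz | hpos
    · exact ⟨t, ht, hz⟩
    · obtain ⟨t', htt', hS⟩ := hSio t
      have h1 := smz_mono hij hjk hik hs W hP hex h0 hdead ht htt'
      have h2 := smz_succ_succ_le hij hjk hik hs W hP hex h0 hdead (le_trans ht htt') hS
      have h3 : smz W k i j (t' + 2) ≤ smz W k i j (t' + 1) :=
        smz_succ_le hij hjk hik hs W hP hex h0 hdead (by omega : N ≤ t' + 1)
      exact ih (smz W k i j (t' + 2)) (by omega) (t' + 2) (by omega) le_rfl

/-- **HALVING (PROVED, effective):** across a proximity repeat the wall-layer-`0` strict multiplicity at least halves.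
[new] [folklore] -/
theorem two_mul_smz_le (hs : IsRoot q s₀) (W : ForcedWalk q s₀) {N : ℕ}
    (hP : ∀ t, N ≤ t → W.j t ≠ k ∧ W.b t k = 0) (hex : ∀ t, N ≤ t → ordZero (W.st t).F ≠ (q : ℕ∞))
    (h0 : ∀ t, N ≤ t → ∃ d ∈ (W.st t).F.support, d k = 0)
    (hdead : ∀ t, N ≤ t → ∀ a, 1 ≤ a → a < q → sm (layer k a (W.st t).F) i j = 0)
    {t : ℕ} (ht : N ≤ t) (hS : StaysOnNewest W t) : 2 * smz W k i j (t + 2) ≤ smz W k i j t := by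
  have h1 := smz_succ_succ_le hij hjk hik hs W hP hex h0 hdead ht hS
  have h2 : smz W k i j (t + 2) ≤ smz W k i j (t + 1) :=
    smz_succ_le hij hjk hik hs W hP hex h0 hdead (by omega : N ≤ t + 1)
  omega

/-- **THE GHOST-WALL LAW, walk form (PROVED, hypothesis-free, every `q`, every field):** no forced walk from a root
has a planar tail (wall `u_k`, excess plateau) whose wall layer `0` is NON-EMPTY, whose live layers `1 … q−1` are
monomial-led, with infinitely many proximity repeats AND infinitely many translated moves.  Proof: the wall layer `0`
becomes monomial-led at the repeats (`exists_smz_eq_zero`), which the tree's g24 law `layer_zero_not_monomialLed`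
forbids. [new] [folklore] -/
theorem no_ghost_tail (hs : IsRoot q s₀) (W : ForcedWalk q s₀) {N : ℕ}
    (hP : ∀ t, N ≤ t → W.j t ≠ k ∧ W.b t k = 0) (hex : ∀ t, N ≤ t → ordZero (W.st t).F ≠ (q : ℕ∞))
    (h0 : ∀ t, N ≤ t → ∃ d ∈ (W.st t).F.support, d k = 0)
    (hdead : ∀ t, N ≤ t → ∀ a, 1 ≤ a → a < q → sm (layer k a (W.st t).F) i j = 0)
    (hSio : ∀ M : ℕ, ∃ t, M ≤ t ∧ StaysOnNewest W t) (hb : ∀ M : ℕ, ∃ t, M ≤ t ∧ W.b t ≠ 0) : False := by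
  obtain ⟨T, hNT, hT⟩ := exists_smz_eq_zero hij hjk hik hs W hP hex h0 hdead hSio
  exact layer_zero_not_monomialLed hij hjk hik hs W hP h0 hdead hb T hNT hT

end Walk

section Classes

open Summit.ResolutionOfSingularities.ResolutionOfSingularities.Theorems.PlanarPort
open Summit.ResolutionOfSingularities.ResolutionOfSingularities.Theorems.SectionLift

/-! ## §3 The classes: the planar side of 31770 is EMPTY; the node equation; `closes` -/

/-- **PIECE 1 (the PORT class of g19–g26) PROVED, hypothesis-free, BY NAME: the monomial-led planar case of the joint
residual is EMPTY** — every `q = p^e`, every perfect field, no port, no [HP24] proposition. · tag DECIDED (tree theorem).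
[new] [folklore] -/
theorem noMonomialLedPlanarJointTailsDeep_holds : NoMonomialLedPlanarJointTailsDeep := by
  intro p hp e he K _ _ _ _ s₀ hs W hsh N hpl hex hS hb i j k hij hjk hik hP h0 hled
  classical
  exact no_ghost_tail hij hjk hik hs W hP hex h0
    (fun t ht a ha1 haq => (sm_eq_zero_iff_isMonomialLed (layer k a (W.st t).F) i j).mpr (hled t ht a ha1 haq)) hS hb

/-- PIECE 1 in PlanarCut letters, PROVED BY NAME. [new] [folklore] -/
theorem noMonomialPlanarJointTailsDeep_holds : NoMonomialPlanarJointTailsDeep :=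
  monomialPlanar_iff_monomialLed.mpr noMonomialLedPlanarJointTailsDeep_holds

/-- **THE PLANAR WINDOW OF THE JOINT RESIDUAL IS EMPTY (PROVED BY NAME, hypothesis-free):** no forced walk from a root
with an excess plateau, infinitely many proximity repeats and infinitely many translated moves has a planar tail —
ghost walls included. [new] [folklore] -/
theorem noPlanarJointTailsDeep_holds : NoPlanarJointTailsDeep :=
  planar_iff_monomial.mpr noMonomialPlanarJointTailsDeep_holds

/-- lens-3/lens-5 `FreezeCut` letter of the same class, PROVED BY NAME. [new] [folklore] -/
theorem noHighPlanarJointTailsDeep_holds : FreezeCut.NoHighPlanarJointTailsDeep :=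
  FreezeCut.planar_iff_highPlanar.mp noPlanarJointTailsDeep_holds

/-- g24's H-P half (the NON-TERMINAL section class) PROVED BY NAME — without [HP24] Prop. 3 / Prop. 4. [new] [folklore] -/
theorem noNonTerminalSectionPlanarJointTailsDeep_holds : NoNonTerminalSectionPlanarJointTailsDeep :=
  nonTerminalSection_of_monomialLed noMonomialLedPlanarJointTailsDeep_holds

/-- g24's terminal leaf PROVED BY NAME. [new] [folklore] -/
theorem noTerminalSectionPlanarJointTailsDeep_holds : NoTerminalSectionPlanarJointTailsDeep :=
  terminalSection_of_monomialLed noMonomialLedPlanarJointTailsDeep_holds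

/-- **(T-2′) THE LOW-LIVE CLASS DECIDED: EMPTY, PROVED BY NAME, hypothesis-free** (critic row 177's binding target,
tree decl `SectionLift.NoLowLiveTerminalSectionPlanarTailsDeep`). [new] [folklore] -/
theorem noLowLiveTerminalSectionPlanarTailsDeep_holds : NoLowLiveTerminalSectionPlanarTailsDeep :=
  lowLiveTerminal_of_terminal noTerminalSectionPlanarJointTailsDeep_holds

/-- g25's low-empty class PROVED BY NAME. [new] [folklore] -/
theorem noLowEmptyTerminalSectionPlanarTailsDeep_holds : NoLowEmptyTerminalSectionPlanarTailsDeep :=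
  lowEmptyTerminal_of_terminal noTerminalSectionPlanarJointTailsDeep_holds

/-- **THE NODE EQUATION (PROVED, hypothesis-free, EXACT): `MaxContactCut.DefectWalksDeep` (31770) `⟺` the SKEW
residual** — the deep arc law (lens-3 `noFreePointTailsDeep_holds`) and the whole planar window
(`noPlanarJointTailsDeep_holds`) are TREE THEOREMS and drop out of the cut `defectWalksDeep_iff_led_skew` exactly.
[new] [folklore] -/
theorem defectWalksDeep_iff_skew : MaxContactCut.DefectWalksDeep ↔ NoSkewJointTailsDeep :=
  defectWalksDeep_iff_led_skew.trans
    ⟨fun h => h.2.2, fun h => ⟨noFreePointTailsDeep_holds, noMonomialLedPlanarJointTailsDeep_holds, h⟩⟩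

/-- **THE NODE EQUATION ON THE CURRENT SKEW LEAVES (PROVED, hypothesis-free, EXACT):** 31770 `⟺` positive skew leaf
`∧` null-flat skew leaf (tree `StallVertex` rev 8). [new] [folklore] -/
theorem defectWalksDeep_iff_skewLeaves : MaxContactCut.DefectWalksDeep ↔
    StallVertex.NoPositiveSkewStalledTailsDeep ∧ StallVertex.NoNullFlatSkewStalledTailsDeep :=
  StallVertex.defectWalksDeep_iff_positive_nullFlat.trans
    ⟨fun h => h.2.2, fun h => ⟨noFreePointTailsDeep_holds, noPlanarJointTailsDeep_holds, h⟩⟩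

/-- **`closes` (PROVED): the skew residual ALONE `⟹ MaxContactCut.DefectWalksDeep`** — 31770 BY NAME; the g24–g26
hypotheses `hA` (arc law), `hP3`/`hP4` ([HP24] Prop. 3/4), `hE`/`hL` (the two terminal section classes) are ALL
discharged by tree theorems. [new] [folklore] -/
theorem closes (hR : NoSkewJointTailsDeep) : MaxContactCut.DefectWalksDeep :=
  defectWalksDeep_iff_skew.mpr hR

/-- `closes` on the current skew leaves. [new] [folklore] -/
theorem closes_leaves (hI : StallVertex.NoPositiveSkewStalledTailsDeep)
    (hZ : StallVertex.NoNullFlatSkewStalledTailsDeep) : MaxContactCut.DefectWalksDeep :=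
  defectWalksDeep_iff_skewLeaves.mpr ⟨hI, hZ⟩

end Classes

end Summit.ResolutionOfSingularities.ResolutionOfSingularities.Theorems.GhostDescent
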